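import Summits.CriticalPhenomena.PercolationContinuityZ3.Theorems.PercNearOneGluingNoHeavyRsw3SetToSetHardCrossingPatches
import HarnessLib

/-!
# RSW3 lane (P2, gen 16): THE EVERY-`p` ENGINE — under (A2)□ at aspect `(s, L)` the block `{0..N} × {0..W}²` of `ℤ³` is crossed the
# long way with probability `≥ (ϰ u)^(K+1) · e / (t+1)²` (`u` an annulus crossing, `e` an EASY block crossing)

builds on p205010 (kernel theorem, internal audit signed; external expert review pending) — NOT used in this file.

Cell `prim-rsw3`, prover seat `prim-rsw3-p2` (gen 16), memo `run/shared/lean/prim/rsw3/P2-RSWLITE.md` §23.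
Support file (`--supports stmt-CriticalPhenomena-4575`); no definitions, no named facts, no sorries.

`pow_mul_div_le_real_boxCross_of_setToSetQuasiMultAspectAt` (bond percolation on `ℤ³`, ANY `p`): if `Crossing.SetToSetQuasiMultAspectAt 3 p s L ϰ`
(`2 ≤ s ≤ L`, `ϰ ≥ 0`), `m ≥ 1`, `W ≥ 2Lm + sm + (2sm+1)t`, `N ≥ 1` and `N + m ≤ Lm + 1 + K(s-1)m`, then

  `(ϰ · P_p(Λ(m) ↔ ∂ⁱⁿΛ(sm) in Λ(sm)))^(K+1) · P_p(boxCross ![(L-s)m+1, ℓ, ℓ] 0) / (t+1)² ≤ P_p(boxCross ![N, W, W] 0)`,  `ℓ = (2sm+1)(t+1) - 1`.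

PROOF.  Choose the patch `(a, b)` of `exists_le_real_openCrossing_patch` for the easy block `{0..(L-s)m+1} × {0..ℓ}²`; put the centres
`c_k = (z₀ + k(s-1)m, o + (2sm+1)a, o + (2sm+1)b)`, `z₀ = N - Lm - 1 - K(s-1)m`, `o = Lm + sm`, the column `Z = [z₀ - Lm, N] × [0, W]²` and its top
face `Y`; the chain `pow_succ_mul_real_openCrossing_innerBoundary_le` of `…Rsw3SetToSetHardCrossingChain` gives
`(ϰu)^(K+1) · P[Y ↔ ∂ⁱⁿΛ_{c_K}(sm) in Z] ≤ P[Λ_{c₀}(m) ↔ Y in Z]`; the translate by `(N - (L-s)m - 1, Lm, Lm)` of the easy block lies in `Z`, its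
top face in `Y`, and the chosen patch in the top face of `Λ_{c_K}(sm) ⊆ ∂ⁱⁿΛ_{c_K}(sm)` (so the sphere factor is `≥ e/(t+1)²` by
`bondPercolation_real_image`); finally `Λ_{c₀}(m) ⊆ {x₀ ≤ 0}`, so `mem_boxCross_of_mem_openConnIn_column` turns `{Λ_{c₀}(m) ↔ Y in Z}` into the hard
crossing.  At `p_c(ℤ³)` the factors `u`, `e` are bounded below uniformly in `m` (annulus window, easy bricks): file `…Rsw3SetToSetHardCrossing`.

References: D. Basu, A. Sapozhnikov, Electron. Commun. Probab. 22 (2017) no. 26, §1 (A2) [BasuSapozhnikov2017ECP]; H. Kesten, *Percolation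
Theory for Mathematicians* (1982), §3.3 Comment (v) [Kesten1982]; G. Grimmett, *Percolation* (1999), §11.7 (RSW gluing) [GrimmettPercolation1999].
[folklore]
-/

noncomputable section

namespace Summit.CriticalPhenomena.PercolationContinuityZ3.Theorems

namespace Rsw3

open MeasureTheory Literature.Probability.LatticeModels Literature.Probability.Percolation
open SurfaceTension Crossing SimpleGraph

/-! ## The every-`p` engine -/

/-- Reducing the constant of (A2)□ keeps it (used to assume `ϰ ≤ 1`). [cite: BasuSapozhnikov2017ECP, §1 assumption (A2)] -/
theorem setToSetQuasiMultAspectAt_of_le {d : ℕ} {p : unitInterval} {s L : ℕ} {ϰ ϰ' : ℝ} (hle : ϰ' ≤ ϰ)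
    (h : SetToSetQuasiMultAspectAt d p s L ϰ) : SetToSetQuasiMultAspectAt d p s L ϰ' := by
  intro m hm Z hZ X hX Y hY
  refine le_trans ?_ (h m hm Z hZ X hX Y hY)
  exact mul_le_mul_of_nonneg_right hle (mul_nonneg measureReal_nonneg measureReal_nonneg)

/-- **THE EVERY-`p` ENGINE.**  Bond percolation on `ℤ³`, any `p`; (A2)□ at aspect `(s, L)` with `2 ≤ s ≤ L` and constant `ϰ ≥ 0`;
scale `m ≥ 1`; `t, K : ℕ`; a block `{0..N} × {0..W}²` (`N ≥ 1`) with `W ≥ 2Lm + sm + (2sm+1)t` (room for the column and the `(t+1)²`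
patches) and `N + m ≤ Lm + 1 + K(s-1)m` (the chain of `K` steps of `(s-1)m` reaches below the bottom face).  Then
`(ϰ·u)^(K+1) · e / (t+1)² ≤ P_p(boxCross ![N, W, W] 0)` with `u = P_p(Λ(m) ↔ ∂ⁱⁿΛ(sm) in Λ(sm))` (`boxCrossing 3 m (s m)`) and
`e = P_p(boxCross ![(L-s)m+1, ℓ, ℓ] 0)`, `ℓ = (2sm+1)(t+1) - 1` (an EASY shape).
[cite: BasuSapozhnikov2017ECP, §1 assumption (A2)] [cite: Kesten1982, §3.3 Comment (v)] -/
theorem pow_mul_div_le_real_boxCross_of_setToSetQuasiMultAspectAt {p : unitInterval} {s L : ℕ} {ϰ : ℝ}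
    (h : SetToSetQuasiMultAspectAt 3 p s L ϰ) (hϰ : 0 ≤ ϰ) (hs : 2 ≤ s) (hsL : s ≤ L) {m : ℕ} (hm : 1 ≤ m)
    (t K : ℕ) {N W : ℕ} (hN : 1 ≤ N) (hW : 2 * L * m + s * m + (2 * s * m + 1) * t ≤ W)
    (hK : N + m ≤ L * m + 1 + K * ((s - 1) * m)) :
    (ϰ * (bondPercolation (zdGraph 3) p).real (boxCrossing 3 m (s * m))) ^ (K + 1) *
          (bondPercolation (zdGraph 3) p).real
            (boxCross ![(((L - s) * m + 1 : ℕ) : ℤ), ((2 * s * m + 1) * (t + 1) - 1 : ℕ), ((2 * s * m + 1) * (t + 1) - 1 : ℕ)] 0) /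
        ((t : ℝ) + 1) ^ 2 ≤
      (bondPercolation (zdGraph 3) p).real (boxCross ![(N : ℤ), W, W] 0) := by
  classical
  -- integer bookkeeping: `L = s + j`, `δ = (s-1) m`
  obtain ⟨j, rfl⟩ : ∃ j, L = s + j := ⟨L - s, by omega⟩
  have hLs : s + j - s = j := by omega
  rw [hLs]
  set μ := bondPercolation (zdGraph 3) p with hμ
  set δ : ℕ := (s - 1) * m with hδ
  have hδ' : (δ : ℤ) + m = s * m := by
    rw [hδ]; obtain ⟨s', rfl⟩ : ∃ s', s = s' + 1 := ⟨s - 1, by omega⟩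
    simp only [Nat.add_sub_cancel]; push_cast; ring
  have hm1 : (1 : ℤ) ≤ m := by exact_mod_cast hm
  have hm0 : (0 : ℤ) ≤ m := by positivity
  have hj0 : (0 : ℤ) ≤ (j : ℤ) * m := by positivity
  have hs0 : (0 : ℤ) ≤ (s : ℤ) * m := by positivity
  have hδ0 : (0 : ℤ) ≤ δ := by positivity
  have hW' : 2 * ((s : ℤ) * m) + 2 * ((j : ℤ) * m) + (s : ℤ) * m + (2 * ((s : ℤ) * m) + 1) * t ≤ W := by
    have := (Nat.cast_le (α := ℤ)).2 hW; push_cast at this; linarith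
  have hK' : (N : ℤ) + m ≤ (s : ℤ) * m + (j : ℤ) * m + 1 + K * δ := by
    have := (Nat.cast_le (α := ℤ)).2 hK; push_cast at this; linarith
  -- the patch
  obtain ⟨a, b, hat, hbt, hpatch⟩ := exists_le_real_openCrossing_patch p (j * m + 1) (2 * s * m) t
  have hat' : (a : ℤ) ≤ t := by exact_mod_cast hat
  have hbt' : (b : ℤ) ≤ t := by exact_mod_cast hbt
  have ha0 : (0 : ℤ) ≤ (2 * ((s : ℤ) * m) + 1) * a := by positivity
  have hb0 : (0 : ℤ) ≤ (2 * ((s : ℤ) * m) + 1) * b := by positivity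
  have haT : (2 * ((s : ℤ) * m) + 1) * a ≤ (2 * ((s : ℤ) * m) + 1) * t := mul_le_mul_of_nonneg_left hat' (by positivity)
  have hbT : (2 * ((s : ℤ) * m) + 1) * b ≤ (2 * ((s : ℤ) * m) + 1) * t := mul_le_mul_of_nonneg_left hbt' (by positivity)
  have hℓ' : (((2 * s * m + 1) * (t + 1) - 1 : ℕ) : ℤ) = (2 * ((s : ℤ) * m) + 1) * t + 2 * ((s : ℤ) * m) := by
    have : 1 ≤ (2 * s * m + 1) * (t + 1) := Nat.one_le_iff_ne_zero.2 (by positivity)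
    push_cast [Nat.cast_sub this]; ring
  -- the centres of the chain, the column and its top face
  set z0 : ℤ := (N : ℤ) - (s : ℤ) * m - (j : ℤ) * m - 1 - K * δ with hz0
  set o : ℤ := (s : ℤ) * m + (j : ℤ) * m + (s : ℤ) * m with ho
  set c : ℕ → Site 3 := fun k => ![z0 + k * δ, o + (2 * ((s : ℤ) * m) + 1) * a, o + (2 * ((s : ℤ) * m) + 1) * b] with hc
  set zlo : ℤ := z0 - (s : ℤ) * m - (j : ℤ) * m with hzlo
  set Z : Finset (Site 3) := Finset.Icc (![zlo, 0, 0] : Site 3) ![(N : ℤ), W, W] with hZ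
  set Y : Finset (Site 3) := Z.filter (fun y => y 0 = N) with hY
  have hkK : ∀ k : ℕ, k ≤ K → (k : ℤ) * δ ≤ K * δ := fun k hk =>
    mul_le_mul_of_nonneg_right (by exact_mod_cast hk) hδ0
  have hLm : (((s + j) * m : ℕ) : ℤ) = (s : ℤ) * m + (j : ℤ) * m := by push_cast; ring
  have hsm : ((s * m : ℕ) : ℤ) = (s : ℤ) * m := by push_cast; ring
  -- hypotheses of the chain
  have hstep : ∀ k, k < K → GM.ball (c (k + 1)) m ⊆ GM.ball (c k) (s * m) := by
    intro k hk v hv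
    simp only [hc] at hv ⊢
    rw [mem_ball_vec3_iff] at hv ⊢
    rw [hsm]
    push_cast at hv ⊢
    obtain ⟨⟨h0, h0'⟩, ⟨h1, h1'⟩, ⟨h2, h2'⟩⟩ := hv
    refine ⟨⟨by linarith, by linarith⟩, ⟨by linarith, by linarith⟩, ⟨by linarith, by linarith⟩⟩
  have hballZ : ∀ k, k ≤ K → GM.ball (c k) ((s + j) * m) ⊆ Z := by
    intro k hk v hv
    simp only [hc] at hv
    rw [mem_ball_vec3_iff, hLm] at hv
    obtain ⟨⟨h0, h0'⟩, ⟨h1, h1'⟩, ⟨h2, h2'⟩⟩ := hv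
    have hk' := hkK k hk
    have hk0 : (0 : ℤ) ≤ (k : ℤ) * δ := by positivity
    rw [hZ, mem_Icc_vec3_iff]
    simp only [Matrix.cons_val_zero, Matrix.cons_val_one, Matrix.head_cons, Matrix.cons_val_two, Matrix.tail_cons]
    refine ⟨⟨by linarith, by linarith⟩, ⟨by linarith, by linarith⟩, ⟨by linarith, by linarith⟩⟩
  have hYball : ∀ k, k ≤ K → Y ⊆ Z \ GM.ball (c k) ((s + j) * m) := by
    intro k hk y hy
    rw [hY, Finset.mem_filter] at hy
    refine Finset.mem_sdiff.2 ⟨hy.1, fun hyb => ?_⟩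
    simp only [hc] at hyb
    rw [mem_ball_vec3_iff, hLm, hy.2] at hyb
    linarith [hyb.1.2, hkK k hk]
  -- THE CHAIN
  have hchain := pow_succ_mul_real_openCrossing_innerBoundary_le h hϰ (by omega) (Nat.le_add_right s j) hm Z Y K c
    hstep hballZ hYball
  -- the top: the easy crossing of the translated block lands in the patch below `c K`
  set vsh : Site 3 := ![(N : ℤ) - (j * m + 1 : ℕ), (s : ℤ) * m + (j : ℤ) * m, (s : ℤ) * m + (j : ℤ) * m] with hvsh
  set φ : zdGraph 3 ≃g zdGraph 3 := zdShiftIso vsh with hφ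
  set M : Site 3 := ![((j * m + 1 : ℕ) : ℤ), ((2 * s * m + 1) * (t + 1) - 1 : ℕ), ((2 * s * m + 1) * (t + 1) - 1 : ℕ)] with hM
  have hjm : ((j * m + 1 : ℕ) : ℤ) = (j : ℤ) * m + 1 := by push_cast; ring
  have hNh : (N : ℤ) - (j * m + 1 : ℕ) = z0 + K * δ + (s : ℤ) * m := by
    rw [hz0, hjm]; ring
  have htop : μ.real (openCrossing (↑(Finset.Icc (0 : Site 3) M) : Set (Site 3))
      {y | y ∈ Finset.Icc (0 : Site 3) M ∧ y 0 = (j * m + 1 : ℕ)}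
      {x | x ∈ Finset.Icc (0 : Site 3) M ∧ x 0 = 0 ∧
        (((2 * s * m : ℕ) : ℤ) + 1) * a ≤ x 1 ∧ x 1 ≤ (((2 * s * m : ℕ) : ℤ) + 1) * a + (2 * s * m : ℕ) ∧
        (((2 * s * m : ℕ) : ℤ) + 1) * b ≤ x 2 ∧ x 2 ≤ (((2 * s * m : ℕ) : ℤ) + 1) * b + (2 * s * m : ℕ)}) ≤
      μ.real (openCrossing (↑Z : Set (Site 3)) ↑Y ↑(innerBoundary (zdGraph 3) (GM.ball (c K) (s * m)))) := by
    rw [hμ, ← bondPercolation_real_image φ p]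
    have h2sm : ((2 * s * m : ℕ) : ℤ) = 2 * ((s : ℤ) * m) := by push_cast; ring
    -- coordinates of the translated block
    have hb0 : M 0 = (j : ℤ) * m + 1 := by simp only [hM, Matrix.cons_val_zero, hjm]
    have hb1 : M 1 = (2 * ((s : ℤ) * m) + 1) * t + 2 * ((s : ℤ) * m) := by
      simp only [hM, Matrix.cons_val_one, Matrix.cons_val_zero, hℓ']
    have hb2 : M 2 = (2 * ((s : ℤ) * m) + 1) * t + 2 * ((s : ℤ) * m) := by
      simp only [hM, Matrix.cons_val_two, Matrix.tail_cons, Matrix.head_cons, hℓ']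
    have hφv : ∀ v : Site 3, (φ : Site 3 → Site 3) v = v + vsh := fun v => rfl
    have e0 : ∀ v : Site 3, (v + vsh) 0 = v 0 + (z0 + K * δ + (s : ℤ) * m) := fun v => by
      rw [Pi.add_apply, hvsh, Matrix.cons_val_zero, hNh]
    have e1 : ∀ v : Site 3, (v + vsh) 1 = v 1 + ((s : ℤ) * m + (j : ℤ) * m) := fun v => by
      simp only [Pi.add_apply, hvsh, Matrix.cons_val_one, Matrix.cons_val_zero]
    have e2 : ∀ v : Site 3, (v + vsh) 2 = v 2 + ((s : ℤ) * m + (j : ℤ) * m) := fun v => by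
      simp only [Pi.add_apply, hvsh, Matrix.cons_val_two, Matrix.tail_cons, Matrix.head_cons]
    have hK0 : (0 : ℤ) ≤ (K : ℤ) * δ := by positivity
    have hmemZ : ∀ v : Site 3, v ∈ Finset.Icc (0 : Site 3) M → v + vsh ∈ Z := by
      intro v hv
      rw [mem_Icc_vec3_iff, hb0, hb1, hb2] at hv
      simp only [Pi.zero_apply] at hv
      obtain ⟨⟨h0, h0'⟩, ⟨h1, h1'⟩, ⟨h2, h2'⟩⟩ := hv
      rw [hZ, mem_Icc_vec3_iff, e0 v, e1 v, e2 v]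
      simp only [Matrix.cons_val_zero, Matrix.cons_val_one, Matrix.head_cons, Matrix.cons_val_two, Matrix.tail_cons]
      refine ⟨⟨by linarith only [hzlo, h0, hK0, hs0, hj0], by linarith only [hz0, h0']⟩,
        ⟨by linarith only [h1, hs0, hj0], by linarith only [h1', hW', hj0]⟩,
        ⟨by linarith only [h2, hs0, hj0], by linarith only [h2', hW', hj0]⟩⟩
    refine measureReal_mono (openCrossing_mono ?_ ?_ ?_) (measure_ne_top _ _)
    · rintro _ ⟨v, hv, rfl⟩
      rw [hφv, Finset.mem_coe]
      exact hmemZ v (Finset.mem_coe.1 hv)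
    · rintro _ ⟨v, ⟨hv, hv0⟩, rfl⟩
      rw [hφv, Finset.mem_coe, hY, Finset.mem_filter]
      refine ⟨hmemZ v hv, ?_⟩
      rw [e0, hv0, hz0]; push_cast; ring
    · rintro _ ⟨v, ⟨hv, hv0, hv1, hv1', hv2, hv2'⟩, rfl⟩
      rw [h2sm] at hv1 hv1' hv2 hv2'
      rw [hφv, Finset.mem_coe, mem_innerBoundary_iff]
      have hvball : v + vsh ∈ GM.ball (c K) (s * m) := by
        simp only [hc]
        rw [mem_ball_vec3_iff, hsm, e0 v, e1 v, e2 v, hv0, ho]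
        refine ⟨⟨by linarith only [hs0], by linarith only [hs0]⟩, ⟨by linarith only [hv1], by linarith only [hv1']⟩,
          ⟨by linarith only [hv2], by linarith only [hv2']⟩⟩
      refine ⟨hvball, v + vsh + Pi.single 0 1, fun hmem => ?_, ?_⟩
      · simp only [hc] at hmem
        rw [mem_ball_vec3_iff, hsm] at hmem
        have h00 := hmem.1.2
        rw [Pi.add_apply, e0 v, hv0, Pi.single_eq_same] at h00
        linarith only [h00]
      · exact (zdGraph_adj_iff _ _).2 ⟨0, Or.inl rfl⟩
  -- the bottom: last exit through the bottom face
  have hbot : μ.real (openCrossing (↑Z : Set (Site 3)) ↑(GM.ball (c 0) m) ↑Y) ≤ μ.real (boxCross ![(N : ℤ), W, W] 0) := by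
    refine DCT16.real_mono_of_forall_subset_edgeSet (zdGraph 3) p fun ω hω hmem => ?_
    obtain ⟨x, hx, y, hy, hxy⟩ := hmem
    rw [Finset.mem_coe] at hx hy
    simp only [hc] at hx
    rw [mem_ball_vec3_iff] at hx
    rw [hY, Finset.mem_filter] at hy
    have hx0 : x 0 ≤ 0 := by push_cast at hx; linarith [hx.1.2]
    exact mem_boxCross_of_mem_openConnIn_column hN hx0 hy.1 hy.2 hω hxy
  -- assemble
  have hq : 0 ≤ (ϰ * μ.real (boxCrossing 3 m (s * m))) ^ (K + 1) := pow_nonneg (mul_nonneg hϰ measureReal_nonneg) _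
  calc (ϰ * μ.real (boxCrossing 3 m (s * m))) ^ (K + 1) * μ.real (boxCross M 0) / ((t : ℝ) + 1) ^ 2
      = (ϰ * μ.real (boxCrossing 3 m (s * m))) ^ (K + 1) * (μ.real (boxCross M 0) / ((t : ℝ) + 1) ^ 2) := by ring
    _ ≤ (ϰ * μ.real (boxCrossing 3 m (s * m))) ^ (K + 1) *
          μ.real (openCrossing (↑Z : Set (Site 3)) ↑Y ↑(innerBoundary (zdGraph 3) (GM.ball (c K) (s * m)))) :=
        mul_le_mul_of_nonneg_left (hpatch.trans htop) hq
    _ ≤ μ.real (openCrossing (↑Z : Set (Site 3)) ↑(GM.ball (c 0) m) ↑Y) := hchain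
    _ ≤ μ.real (boxCross ![(N : ℤ), W, W] 0) := hbot

end Rsw3

end Summit.CriticalPhenomena.PercolationContinuityZ3.Theorems
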